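import Summits.CriticalPhenomena.PercolationContinuityZ3.Theorems.PercNearOneGluingNoHeavyConstsClusterSquareApexGap
import HarnessLib

/-!
# Gap lemmas for an outerplanar graph with SEVERAL independent apices: two-graph crossing with a hub predicate, hub contraction

builds on p205010 (kernel theorem, internal audit signed; external expert review pending)

PAPER-2 track "percolation constants", part (ii), seat `prim-consts-1`, gen 20 (lane index
`run/shared/lean/prim/consts/CONSTANTS.md`, row A19; memo `FROM-prim-consts-1-g20-APEX-FACE.md` §0(4), §3(iii)).
Support file for the crux `NoHeavyLowerTail` (stmt-CriticalPhenomena-4575; `--supports`).  Theorems only; no definitions, no sorries.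

This is the many-apex version of `…ConstsClusterSquareApexGap.lean` (one apex `h`).  SETTING: `H` on `Fin n`; a HUB PREDICATE `hub`
(the apices); the other (RIM) vertices carry positions `pos u : Fin m`, injective on the rim; hubs are pairwise non-adjacent.  Auxiliary
graphs enter as PARAMETERS: a rim graph `G₀` (⊇ the `H`-edges between rim vertices), for every vertex set `S` a contracted graph `Hp S`
(⊇ rim edges and a CHORD `{u,v}` for every two rim neighbours `u ≠ v` of a hub IN `S`), and for every hub `x` its chord graph `C x`
(⊇ the chords of `x`).  The standing geometric hypotheses: no `Hp S`-edge crosses a `G₀`-edge, and no `Hp S`-edge crosses a `C x`-edge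
for a hub `x ∉ S` (for the intended graphs: rim edges pairwise non-crossing, no rim edge separates two neighbours of a hub, no chord of
one hub interleaves a chord of another hub).
RESULTS: `Apices.cnt_eq_of_adj₂` (two-graph gap lemma, rim-predicate form), `Apices.toRim`, `Apices.contract` (hub contraction of an
`H`-walk inside a set `T` to an `Hp`-walk whose chords belong to hubs in `T`), and the MASTER LEMMA `Apices.cnt_eq_of_walk`: for `S ∋ a`
(`a` on the rim) `H`-connected inside `S` and an `H`-walk `W` avoiding `S`, all rim vertices of `W` lie in one gap of the rim part of `S`
(a rim step is a `G₀`-edge, a hub step `u ~ x ~ v` has `x ∉ S` and is a `C x`-chord; both are tested against the `Hp S`-connected rim part).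
References: N. Gladkov, arXiv:2408.08457v2 (2024); G. Chartrand, F. Harary, Ann. Inst. H. Poincaré B 3 (1967) 433–438.
-/

noncomputable section

open Classical

namespace Summit.CriticalPhenomena.PercolationContinuityZ3.Theorems

open MeasureTheory Finset Literature.Probability.LatticeModels Literature.Probability.Percolation

namespace Consts

namespace Apices

variable {n m : ℕ} {pos : Fin n → Fin m} {hub : Fin n → Prop}

/-! ### The two-graph gap lemma (rim-predicate form) -/

/-- KEY LEMMA, two-graph ordered form with a hub predicate: `S` (rim vertices only) is connected from `o` by `G₁`-walks inside `S`;
`x, x'` are rim vertices outside `S` joined by a `G₂`-edge; no `G₁`-edge crosses a `G₂`-edge in the order cut open at `o`.  Then `x, x'`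
have the same number of `S`-vertices before them. [folklore: discrete Jordan curve theorem on a cycle] -/
theorem cnt_eq_of_adj_lt₂ {G₁ G₂ : SimpleGraph (Fin n)} {o : Fin n}
    (hpos : ∀ u v, ¬ hub u → ¬ hub v → pos u = pos v → u = v)
    (h12 : ∀ p q r s : Fin n, G₁.Adj p q → G₂.Adj r s → (pos p - pos o).val < (pos r - pos o).val →
      (pos r - pos o).val < (pos q - pos o).val → (pos q - pos o).val < (pos s - pos o).val → False)
    (h21 : ∀ p q r s : Fin n, G₂.Adj p q → G₁.Adj r s → (pos p - pos o).val < (pos r - pos o).val →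
      (pos r - pos o).val < (pos q - pos o).val → (pos q - pos o).val < (pos s - pos o).val → False)
    {S : Set (Fin n)} (hSr : ∀ s ∈ S, ¬ hub s) (hS : ∀ s ∈ S, ∃ W : G₁.Walk o s, ∀ v ∈ W.support, v ∈ S)
    {x x' : Fin n} (hx : x ∉ S) (hx' : x' ∉ S) (hxh : ¬ hub x) (hx'h : ¬ hub x') (hadj : G₂.Adj x x')
    (hlt : (pos x - pos o).val < (pos x' - pos o).val) :
    (Finset.univ.filter (fun s => s ∈ S ∧ (pos s - pos o).val < (pos x - pos o).val)).card =
      (Finset.univ.filter (fun s => s ∈ S ∧ (pos s - pos o).val < (pos x' - pos o).val)).card := by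
  by_contra hne
  obtain ⟨k₁, hk₁S, hk₁a, hk₁b⟩ : ∃ k₁ ∈ S, (pos x - pos o).val < (pos k₁ - pos o).val ∧
      (pos k₁ - pos o).val < (pos x' - pos o).val := by
    by_contra hno
    push Not at hno
    have hsub : Finset.univ.filter (fun s => s ∈ S ∧ (pos s - pos o).val < (pos x' - pos o).val) ⊆
        Finset.univ.filter (fun s => s ∈ S ∧ (pos s - pos o).val < (pos x - pos o).val) := by
      intro s hs
      rw [mem_filter] at hs ⊢
      refine ⟨hs.1, hs.2.1, ?_⟩
      by_contra hge
      push Not at hge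
      have hne' : (pos x - pos o).val ≠ (pos s - pos o).val := fun e =>
        hx (hpos x s hxh (hSr s hs.2.1) (NonCrossing.rot_injective (pos o) e) ▸ hs.2.1)
      exact absurd hs.2.2 (not_lt.2 (hno s hs.2.1 (lt_of_le_of_ne hge hne')))
    have h1 := card_le_card hsub
    have h2 := NonCrossing.cnt_mono_pos (pos := pos) o S hlt.le
    omega
  obtain ⟨W, hW⟩ := hS k₁ hk₁S
  let A : Set (Fin n) := {v | (pos x - pos o).val < (pos v - pos o).val ∧ (pos v - pos o).val < (pos x' - pos o).val}
  have hk₁A : k₁ ∈ A := ⟨hk₁a, hk₁b⟩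
  have hoA : o ∉ A := fun ho => by
    have h' : (pos x - pos o).val < (pos o - pos o).val := ho.1
    rw [NonCrossing.rot_self] at h'
    exact Nat.not_lt_zero _ h'
  obtain ⟨d, hd, hd1, hd2⟩ := W.reverse.exists_boundary_dart A hk₁A hoA
  have hvS : d.snd ∈ S := by
    refine hW _ ?_
    have := W.reverse.dart_snd_mem_support_of_mem_darts hd
    rwa [SimpleGraph.Walk.support_reverse, List.mem_reverse] at this
  have hvh : ¬ hub d.snd := hSr _ hvS
  have hvx : (pos d.snd - pos o).val ≠ (pos x - pos o).val := fun e =>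
    hx (hpos d.snd x hvh hxh (NonCrossing.rot_injective (pos o) e) ▸ hvS)
  have hvx' : (pos d.snd - pos o).val ≠ (pos x' - pos o).val := fun e =>
    hx' (hpos d.snd x' hvh hx'h (NonCrossing.rot_injective (pos o) e) ▸ hvS)
  have hu1 : (pos x - pos o).val < (pos d.fst - pos o).val := hd1.1
  have hu2 : (pos d.fst - pos o).val < (pos x' - pos o).val := hd1.2
  have hd2' : ¬ ((pos x - pos o).val < (pos d.snd - pos o).val ∧ (pos d.snd - pos o).val < (pos x' - pos o).val) := hd2
  rcases not_and_or.1 hd2' with hle | hle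
  · exact h12 d.snd d.fst x x' d.adj.symm hadj (lt_of_le_of_ne (not_lt.1 hle) hvx) hu1 hu2
  · exact h21 x x' d.fst d.snd hadj d.adj hu1 hu2 (lt_of_le_of_ne (not_lt.1 hle) (Ne.symm hvx'))

/-- KEY LEMMA, two-graph form with a hub predicate (either order of the two positions). [folklore] -/
theorem cnt_eq_of_adj₂ {G₁ G₂ : SimpleGraph (Fin n)} {o : Fin n}
    (hpos : ∀ u v, ¬ hub u → ¬ hub v → pos u = pos v → u = v)
    (h12 : ∀ p q r s : Fin n, G₁.Adj p q → G₂.Adj r s → (pos p - pos o).val < (pos r - pos o).val →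
      (pos r - pos o).val < (pos q - pos o).val → (pos q - pos o).val < (pos s - pos o).val → False)
    (h21 : ∀ p q r s : Fin n, G₂.Adj p q → G₁.Adj r s → (pos p - pos o).val < (pos r - pos o).val →
      (pos r - pos o).val < (pos q - pos o).val → (pos q - pos o).val < (pos s - pos o).val → False)
    {S : Set (Fin n)} (hSr : ∀ s ∈ S, ¬ hub s) (hS : ∀ s ∈ S, ∃ W : G₁.Walk o s, ∀ v ∈ W.support, v ∈ S)
    {x x' : Fin n} (hx : x ∉ S) (hx' : x' ∉ S) (hxh : ¬ hub x) (hx'h : ¬ hub x') (hadj : G₂.Adj x x') :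
    (Finset.univ.filter (fun s => s ∈ S ∧ (pos s - pos o).val < (pos x - pos o).val)).card =
      (Finset.univ.filter (fun s => s ∈ S ∧ (pos s - pos o).val < (pos x' - pos o).val)).card := by
  rcases lt_trichotomy ((pos x - pos o).val) ((pos x' - pos o).val) with hlt | heq | hgt
  · exact cnt_eq_of_adj_lt₂ hpos h12 h21 hSr hS hx hx' hxh hx'h hadj hlt
  · rw [heq]
  · exact (cnt_eq_of_adj_lt₂ hpos h12 h21 hSr hS hx' hx hx'h hxh hadj.symm hgt).symm

/-! ### Rim transfer and hub contraction (hub predicate) -/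

/-- A hub-free `H`-walk is a walk in any graph `G₀` containing the rim edges of `H`. [folklore] -/
theorem toRim {H G₀ : SimpleGraph (Fin n)} (g1 : ∀ u v, H.Adj u v → ¬ hub u → ¬ hub v → G₀.Adj u v)
    {u v : Fin n} (W : H.Walk u v) (hW : ∀ z ∈ W.support, ¬ hub z) :
    ∃ W' : G₀.Walk u v, ∀ z ∈ W'.support, z ∈ W.support := by
  induction W with
  | nil => exact ⟨SimpleGraph.Walk.nil, fun z hz => hz⟩
  | @cons u w v huw W ih =>
    obtain ⟨W', hW'⟩ := ih (fun z hz => hW z (by simp [hz]))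
    refine ⟨SimpleGraph.Walk.cons (g1 u w huw (hW u (by simp)) (hW w (by simp))) W', fun z hz => ?_⟩
    rw [SimpleGraph.Walk.support_cons, List.mem_cons] at hz ⊢
    rcases hz with hz | hz
    · exact Or.inl hz
    · exact Or.inr (hW' z hz)

/-- HUB CONTRACTION inside a set `T`: hubs are pairwise non-adjacent; `H'` contains the rim edges of `H` and a chord `{u,v}` for every two rim
neighbours `u ≠ v` of a hub lying in `T`.  Then every `H`-walk inside `T` ending on the rim contracts to an `H'`-walk on the rim part of
its support (from its start if that is a rim vertex; from any rim neighbour `x` of the start if the start is a hub). [folklore] -/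
theorem contract {H H' : SimpleGraph (Fin n)} {T : Set (Fin n)} (hI : ∀ u v, hub u → hub v → ¬ H.Adj u v)
    (g2 : ∀ u v, H.Adj u v → ¬ hub u → ¬ hub v → H'.Adj u v)
    (g3 : ∀ x u v, hub x → x ∈ T → u ≠ v → ¬ hub u → ¬ hub v → H.Adj x u → H.Adj x v → H'.Adj u v)
    {u v : Fin n} (W : H.Walk u v) (hWT : ∀ z ∈ W.support, z ∈ T) (hv : ¬ hub v) :
    (¬ hub u → ∃ W' : H'.Walk u v, ∀ z ∈ W'.support, z ∈ W.support ∧ ¬ hub z) ∧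
    (hub u → ∀ x, ¬ hub x → H.Adj u x → ∃ W' : H'.Walk x v, ∀ z ∈ W'.support, (z = x ∨ z ∈ W.support) ∧ ¬ hub z) := by
  induction W with
  | nil =>
    refine ⟨fun hu => ⟨SimpleGraph.Walk.nil, fun z hz => ?_⟩, fun hu => absurd hu hv⟩
    rw [SimpleGraph.Walk.support_nil, List.mem_singleton] at hz
    subst hz
    exact ⟨SimpleGraph.Walk.start_mem_support _, hu⟩
  | @cons u w v huw W ih =>
    have hWT' : ∀ z ∈ W.support, z ∈ T := fun z hz => hWT z (by simp [hz])
    obtain ⟨ihA, ihB⟩ := ih hWT' hv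
    refine ⟨fun hu => ?_, fun hu x hxh hx => ?_⟩
    · by_cases hw : hub w
      · obtain ⟨W', hW'⟩ := ihB hw u hu huw.symm
        refine ⟨W', fun z hz => ⟨?_, (hW' z hz).2⟩⟩
        rw [SimpleGraph.Walk.support_cons, List.mem_cons]
        rcases (hW' z hz).1 with hz' | hz'
        · exact Or.inl hz'
        · exact Or.inr hz'
      · obtain ⟨W', hW'⟩ := ihA hw
        refine ⟨SimpleGraph.Walk.cons (g2 u w huw hu hw) W', fun z hz => ?_⟩
        rw [SimpleGraph.Walk.support_cons, List.mem_cons] at hz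
        rw [SimpleGraph.Walk.support_cons, List.mem_cons]
        rcases hz with hz | hz
        · exact ⟨Or.inl hz, hz.symm ▸ hu⟩
        · exact ⟨Or.inr (hW' z hz).1, (hW' z hz).2⟩
    · have hwh : ¬ hub w := fun hw => hI u w hu hw huw
      obtain ⟨W', hW'⟩ := ihA hwh
      by_cases hxw : x = w
      · subst hxw
        refine ⟨W', fun z hz => ⟨Or.inr ?_, (hW' z hz).2⟩⟩
        rw [SimpleGraph.Walk.support_cons, List.mem_cons]
        exact Or.inr (hW' z hz).1
      · refine ⟨SimpleGraph.Walk.cons (g3 u x w hu (hWT u (SimpleGraph.Walk.start_mem_support _)) hxw hxh hwh hx huw) W',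
          fun z hz => ?_⟩
        rw [SimpleGraph.Walk.support_cons, List.mem_cons] at hz
        rcases hz with hz | hz
        · exact ⟨Or.inl hz, hz.symm ▸ hxh⟩
        · refine ⟨Or.inr ?_, (hW' z hz).2⟩
          rw [SimpleGraph.Walk.support_cons, List.mem_cons]
          exact Or.inr (hW' z hz).1

/-! ### The master gap lemma for `H`-walks -/

section Master

variable {H G₀ : SimpleGraph (Fin n)} {Hp : Set (Fin n) → SimpleGraph (Fin n)} {C : Fin n → SimpleGraph (Fin n)} {a : Fin n}
  (hpos : ∀ u v, ¬ hub u → ¬ hub v → pos u = pos v → u = v)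
  (hI : ∀ u v, hub u → hub v → ¬ H.Adj u v)
  (g1 : ∀ u v, H.Adj u v → ¬ hub u → ¬ hub v → G₀.Adj u v)
  (g2 : ∀ S u v, H.Adj u v → ¬ hub u → ¬ hub v → (Hp S).Adj u v)
  (g3 : ∀ (S : Set (Fin n)) x u v, hub x → x ∈ S → u ≠ v → ¬ hub u → ¬ hub v → H.Adj x u → H.Adj x v → (Hp S).Adj u v)
  (c1 : ∀ x u v, hub x → u ≠ v → ¬ hub u → ¬ hub v → H.Adj x u → H.Adj x v → (C x).Adj u v)
  (x0 : ∀ (S : Set (Fin n)) p q r s, (Hp S).Adj p q → G₀.Adj r s → (pos p - pos a).val < (pos r - pos a).val →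
    (pos r - pos a).val < (pos q - pos a).val → (pos q - pos a).val < (pos s - pos a).val → False)
  (x0' : ∀ (S : Set (Fin n)) p q r s, G₀.Adj p q → (Hp S).Adj r s → (pos p - pos a).val < (pos r - pos a).val →
    (pos r - pos a).val < (pos q - pos a).val → (pos q - pos a).val < (pos s - pos a).val → False)
  (xC : ∀ (S : Set (Fin n)) x p q r s, hub x → x ∉ S → (Hp S).Adj p q → (C x).Adj r s →
    (pos p - pos a).val < (pos r - pos a).val → (pos r - pos a).val < (pos q - pos a).val →
    (pos q - pos a).val < (pos s - pos a).val → False)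
  (xC' : ∀ (S : Set (Fin n)) x p q r s, hub x → x ∉ S → (C x).Adj p q → (Hp S).Adj r s →
    (pos p - pos a).val < (pos r - pos a).val → (pos r - pos a).val < (pos q - pos a).val →
    (pos q - pos a).val < (pos s - pos a).val → False)
  (ha : ¬ hub a)
include hpos hI g1 g2 g3 c1 x0 x0' xC xC' ha

omit hpos g1 c1 x0 x0' xC xC' in
/-- The rim part `S'` of an `H`-connected `S ∋ a` is `Hp S`-connected from `a` inside `S'` (contraction). [folklore] -/
theorem rimPart_connected {S S' : Set (Fin n)} (hS : ∀ s ∈ S, ∃ W : H.Walk a s, ∀ v ∈ W.support, v ∈ S)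
    (hS' : ∀ s, s ∈ S' ↔ s ∈ S ∧ ¬ hub s) :
    ∀ s ∈ S', ∃ W : (Hp S).Walk a s, ∀ v ∈ W.support, v ∈ S' := by
  intro s hs
  obtain ⟨hsS, hsh⟩ := (hS' s).1 hs
  obtain ⟨W, hW⟩ := hS s hsS
  obtain ⟨W', hW'⟩ := (contract hI (g2 S) (g3 S) W hW hsh).1 ha
  exact ⟨W', fun v hv => (hS' v).2 ⟨hW v (hW' v hv).1, (hW' v hv).2⟩⟩

omit c1 xC xC' in
/-- RIM STEP: two rim vertices outside `S` joined by an `H`-edge lie in the same gap of the rim part of `S`. [folklore] -/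
theorem cnt_eq_of_rimAdj {S S' : Set (Fin n)} (hS : ∀ s ∈ S, ∃ W : H.Walk a s, ∀ v ∈ W.support, v ∈ S)
    (hS' : ∀ s, s ∈ S' ↔ s ∈ S ∧ ¬ hub s) {x x' : Fin n} (hx : x ∉ S) (hx' : x' ∉ S) (hxh : ¬ hub x) (hx'h : ¬ hub x')
    (hadj : H.Adj x x') :
    (Finset.univ.filter (fun s => s ∈ S' ∧ (pos s - pos a).val < (pos x - pos a).val)).card =
      (Finset.univ.filter (fun s => s ∈ S' ∧ (pos s - pos a).val < (pos x' - pos a).val)).card :=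
  cnt_eq_of_adj₂ hpos (x0 S) (x0' S) (fun s hs => ((hS' s).1 hs).2)
    (rimPart_connected hI g2 g3 ha hS hS') (fun h => hx ((hS' x).1 h).1)
    (fun h => hx' ((hS' x').1 h).1) hxh hx'h (g1 x x' hadj hxh hx'h)

omit g1 x0 x0' in
/-- HUB STEP: for a hub `x ∉ S`, two rim neighbours of `x` outside `S` lie in the same gap of the rim part of `S`. [folklore] -/
theorem cnt_eq_of_hubAdj {S S' : Set (Fin n)} (hS : ∀ s ∈ S, ∃ W : H.Walk a s, ∀ v ∈ W.support, v ∈ S)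
    (hS' : ∀ s, s ∈ S' ↔ s ∈ S ∧ ¬ hub s) {x u u' : Fin n} (hxh : hub x) (hxS : x ∉ S) (hu : u ∉ S) (hu' : u' ∉ S)
    (huh : ¬ hub u) (hu'h : ¬ hub u') (h1 : H.Adj x u) (h2 : H.Adj x u') :
    (Finset.univ.filter (fun s => s ∈ S' ∧ (pos s - pos a).val < (pos u - pos a).val)).card =
      (Finset.univ.filter (fun s => s ∈ S' ∧ (pos s - pos a).val < (pos u' - pos a).val)).card := by
  by_cases huu' : u = u'
  · rw [huu']
  · exact cnt_eq_of_adj₂ hpos (xC S x · · · · hxh hxS) (xC' S x · · · · hxh hxS) (fun s hs => ((hS' s).1 hs).2)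
      (rimPart_connected hI g2 g3 ha hS hS') (fun h => hu ((hS' u).1 h).1)
      (fun h => hu' ((hS' u').1 h).1) huh hu'h (c1 x u u' hxh huu' huh hu'h h1 h2)

/-- MASTER LEMMA (several apices): for `S ∋ a` `H`-connected from `a` inside `S` and an `H`-walk `W` avoiding `S`, all RIM vertices of `W`
lie in the same gap of the rim part `S'` of `S`. [folklore: discrete Jordan curve theorem, apices inside faces] -/
theorem cnt_eq_of_walk {S S' : Set (Fin n)} (hS : ∀ s ∈ S, ∃ W : H.Walk a s, ∀ v ∈ W.support, v ∈ S)
    (hS' : ∀ s, s ∈ S' ↔ s ∈ S ∧ ¬ hub s) {p q : Fin n} (W : H.Walk p q) (hW : ∀ v ∈ W.support, v ∉ S) :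
    ∀ u ∈ W.support, ∀ v ∈ W.support, ¬ hub u → ¬ hub v →
      (Finset.univ.filter (fun s => s ∈ S' ∧ (pos s - pos a).val < (pos u - pos a).val)).card =
      (Finset.univ.filter (fun s => s ∈ S' ∧ (pos s - pos a).val < (pos v - pos a).val)).card := by
  induction W with
  | nil =>
    intro u hu v hv _ _
    rw [SimpleGraph.Walk.support_nil, List.mem_singleton] at hu hv
    rw [hu, hv]
  | @cons p p₂ q hp W ih =>
    have hpS : p ∉ S := hW p (SimpleGraph.Walk.start_mem_support _)
    have hW' : ∀ v ∈ W.support, v ∉ S := fun v hv => hW v (by simp [hv])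
    have ih' := ih hW'
    have key : ¬ hub p → ∀ v ∈ W.support, ¬ hub v →
        (Finset.univ.filter (fun s => s ∈ S' ∧ (pos s - pos a).val < (pos p - pos a).val)).card =
        (Finset.univ.filter (fun s => s ∈ S' ∧ (pos s - pos a).val < (pos v - pos a).val)).card := by
      intro hph v hv hvh
      by_cases hp₂ : hub p₂
      · -- hub step: the walk continues `p ~ p₂ ~ p₃` with `p₂` a hub outside `S`
        have hp₂S : p₂ ∉ S := hW' p₂ (SimpleGraph.Walk.start_mem_support _)
        cases W with
        | nil =>
          rw [SimpleGraph.Walk.support_nil, List.mem_singleton] at hv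
          exact absurd (hv ▸ hp₂) hvh
        | @cons _ p₃ _ hp' W'' =>
          have hp₃h : ¬ hub p₃ := fun h3 => hI p₂ p₃ hp₂ h3 hp'
          have hp₃S : p₃ ∉ S := hW' p₃ (by simp)
          have hp₃W : p₃ ∈ (SimpleGraph.Walk.cons hp' W'').support := by simp
          have e2 := ih' p₃ hp₃W v hv hp₃h hvh
          rw [← e2]
          exact cnt_eq_of_hubAdj hpos hI g2 g3 c1 xC xC' ha hS hS' hp₂ hp₂S hpS hp₃S hph hp₃h hp.symm hp'
      · have hp₂S : p₂ ∉ S := hW' p₂ (SimpleGraph.Walk.start_mem_support _)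
        rw [cnt_eq_of_rimAdj hpos hI g1 g2 g3 x0 x0' ha hS hS' hpS hp₂S hph hp₂ hp]
        exact ih' p₂ (SimpleGraph.Walk.start_mem_support _) v hv hp₂ hvh
    intro u hu v hv huh hvh
    rw [SimpleGraph.Walk.support_cons, List.mem_cons] at hu hv
    rcases hu with rfl | hu <;> rcases hv with rfl | hv
    · rfl
    · exact key huh v hv hvh
    · exact (key hvh u hu huh).symm
    · exact ih' u hu v hv huh hvh

/-- The master lemma for the two rim ENDPOINTS of an `H`-walk avoiding `S`. [folklore] -/
theorem cnt_eq_ends {S S' : Set (Fin n)} (hS : ∀ s ∈ S, ∃ W : H.Walk a s, ∀ v ∈ W.support, v ∈ S)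
    (hS' : ∀ s, s ∈ S' ↔ s ∈ S ∧ ¬ hub s) {p q : Fin n} (W : H.Walk p q) (hW : ∀ v ∈ W.support, v ∉ S) (hph : ¬ hub p)
    (hqh : ¬ hub q) :
    (Finset.univ.filter (fun s => s ∈ S' ∧ (pos s - pos a).val < (pos p - pos a).val)).card =
      (Finset.univ.filter (fun s => s ∈ S' ∧ (pos s - pos a).val < (pos q - pos a).val)).card :=
  cnt_eq_of_walk hpos hI g1 g2 g3 c1 x0 x0' xC xC' ha hS hS' W hW p (SimpleGraph.Walk.start_mem_support _) q
    (SimpleGraph.Walk.end_mem_support _) hph hqh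

end Master

end Apices

end Consts

end Summit.CriticalPhenomena.PercolationContinuityZ3.Theorems
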